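import Mathlib.Analysis.InnerProductSpace.PiL2
import HarnessLib

/-!
# Three planar obstructions for penny graphs: `K₄`, `K_{2,3}`, and the five-spoked wheel `W₅`

Venture `Crystal3D` (cell `pub-crystal3d`, seat p2): the two-dimensional control case (unit-diameter discs in `ℝ²`,
contact = distance `1`). Elementary Euclidean geometry, proved by linear algebra (no angles):

* `add_eq_add_of_two_circles` — two distinct points `c ≠ d` at distance `1` from both `a ≠ b` satisfy `c + d = a + b`
  (two unit circles about distinct centres meet in at most two points, mirror images in the line of centres);
* `no_four_pairwise_dist_one_plane` — no four points of the plane are pairwise at distance `1` (`K₄` is not a penny graph);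
* `common_neighbours_le_two_plane` — two distinct points have at most two common points at distance `1` (`K_{2,3}`-freeness);
* `no_planar_five_ring` — five discs around a central disc cannot touch it and each other cyclically (`W₅`: five times
  `60°` is not `360°`; here: the Gram relations force `⟪v_{i−1}, v_{i+1}⟫ = −1/2` and then a non-singular Gram matrix).

These are the refutations behind the small planar contact numbers `c(4) = 5`, `c(5) = 7`, `c(6) = 9`, `c(7) = 12`
(`SmallDiscValues.lean`). HONEST FRAMING: nothing enumerative is claimed here and nothing about crystallization.
-/

noncomputable section

open Real RealInnerProductSpace

namespace Summit.Ventures.Crystal3D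

/-! ### Linear relations in the plane -/

/-- Two vectors of `ℝ²` orthogonal to a non-zero vector satisfy a non-trivial linear relation. [folklore] -/
theorem exists_rel_of_orthogonal_plane {u a b : EuclideanSpace ℝ (Fin 2)} (hu : u ≠ 0)
    (ha : ⟪a, u⟫ = 0) (hb : ⟪b, u⟫ = 0) : ∃ α β : ℝ, (α ≠ 0 ∨ β ≠ 0) ∧ α • a + β • b = 0 := by
  have hdep : ¬ LinearIndependent ℝ ![a, b, u] := by
    intro hli
    have := hli.fintype_card_le_finrank
    rw [finrank_euclideanSpace_fin, Fintype.card_fin] at this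
    omega
  rw [Fintype.not_linearIndependent_iff] at hdep
  obtain ⟨g, hg, i0, hi0⟩ := hdep
  simp only [Fin.sum_univ_three, Matrix.cons_val_zero, Matrix.cons_val_one, Matrix.cons_val] at hg
  have h2 : g 2 = 0 := by
    have e : ⟪g 0 • a + g 1 • b + g 2 • u, u⟫ = 0 := by rw [hg, inner_zero_left]
    rw [inner_add_left, inner_add_left, real_inner_smul_left, real_inner_smul_left, real_inner_smul_left, ha, hb,
      real_inner_self_eq_norm_sq] at e
    have hun : ‖u‖ ^ 2 ≠ 0 := by positivity
    have : g 2 * ‖u‖ ^ 2 = 0 := by linarith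
    exact (mul_eq_zero.1 this).resolve_right hun
  refine ⟨g 0, g 1, ?_, ?_⟩
  · fin_cases i0
    · exact Or.inl hi0
    · exact Or.inr hi0
    · exact absurd h2 hi0
  · rw [h2, zero_smul, add_zero] at hg
    exact hg

/-- Any three vectors of `ℝ²` satisfy a non-trivial linear relation. [folklore] -/
theorem exists_rel_three_plane (a b c : EuclideanSpace ℝ (Fin 2)) :
    ∃ α β γ : ℝ, (α ≠ 0 ∨ β ≠ 0 ∨ γ ≠ 0) ∧ α • a + β • b + γ • c = 0 := by
  have hdep : ¬ LinearIndependent ℝ ![a, b, c] := by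
    intro hli
    have := hli.fintype_card_le_finrank
    rw [finrank_euclideanSpace_fin, Fintype.card_fin] at this
    omega
  rw [Fintype.not_linearIndependent_iff] at hdep
  obtain ⟨g, hg, i0, hi0⟩ := hdep
  simp only [Fin.sum_univ_three, Matrix.cons_val_zero, Matrix.cons_val_one, Matrix.cons_val] at hg
  refine ⟨g 0, g 1, g 2, ?_, hg⟩
  fin_cases i0
  · exact Or.inl hi0
  · exact Or.inr (Or.inl hi0)
  · exact Or.inr (Or.inr hi0)

/-- Inner products of a two-term relation with a test vector. [folklore] -/
theorem inner_rel_two_eq_zero {a b v : EuclideanSpace ℝ (Fin 2)} {α β : ℝ} (h : α • a + β • b = 0) :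
    α * ⟪a, v⟫ + β * ⟪b, v⟫ = 0 := by
  have e : ⟪α • a + β • b, v⟫ = 0 := by rw [h, inner_zero_left]
  rwa [inner_add_left, real_inner_smul_left, real_inner_smul_left] at e

/-- Inner products of a three-term relation with a test vector. [folklore] -/
theorem inner_rel_three_eq_zero {a b c v : EuclideanSpace ℝ (Fin 2)} {α β γ : ℝ} (h : α • a + β • b + γ • c = 0) :
    α * ⟪a, v⟫ + β * ⟪b, v⟫ + γ * ⟪c, v⟫ = 0 := by
  have e : ⟪α • a + β • b + γ • c, v⟫ = 0 := by rw [h, inner_zero_left]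
  rwa [inner_add_left, inner_add_left, real_inner_smul_left, real_inner_smul_left, real_inner_smul_left] at e

/-! ### Two circles -/

/-- **Two unit circles about distinct centres meet in at most two points, mirror images in the line of centres**: if
`a ≠ b`, `c ≠ d` and `c`, `d` are both at distance `1` from `a` and from `b`, then `c + d = a + b`. [folklore] -/
theorem add_eq_add_of_two_circles {a b c d : EuclideanSpace ℝ (Fin 2)} (hab : a ≠ b) (hcd : c ≠ d)
    (hca : dist c a = 1) (hcb : dist c b = 1) (hda : dist d a = 1) (hdb : dist d b = 1) : c + d = a + b := by
  obtain ⟨u, hu⟩ : ∃ u : EuclideanSpace ℝ (Fin 2), u = b - a := ⟨_, rfl⟩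
  have hu0 : u ≠ 0 := by rw [hu, sub_ne_zero]; exact hab.symm
  obtain ⟨wc, hwc⟩ : ∃ w : EuclideanSpace ℝ (Fin 2), w = (c - a) + (c - b) := ⟨_, rfl⟩
  obtain ⟨wd, hwd⟩ : ∃ w : EuclideanSpace ℝ (Fin 2), w = (d - a) + (d - b) := ⟨_, rfl⟩
  have hperp : ∀ p : EuclideanSpace ℝ (Fin 2), dist p a = 1 → dist p b = 1 → ⟪(p - a) + (p - b), u⟫ = 0 := by
    intro p hpa hpb
    have e : u = (p - a) - (p - b) := by rw [hu]; abel
    rw [e, inner_sub_right, inner_add_left, inner_add_left, real_inner_comm (p - a) (p - b),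
      real_inner_self_eq_norm_sq, real_inner_self_eq_norm_sq, ← dist_eq_norm, ← dist_eq_norm, hpa, hpb]
    ring
  have hnorm : ∀ p : EuclideanSpace ℝ (Fin 2), dist p a = 1 → dist p b = 1 →
      ⟪(p - a) + (p - b), (p - a) + (p - b)⟫ = 4 - ‖u‖ ^ 2 := by
    intro p hpa hpb
    have e1 := norm_add_sq_real (p - a) (p - b)
    have e2 := norm_sub_sq_real (p - a) (p - b)
    have e3 : (p - a) - (p - b) = b - a := by abel
    rw [e3, ← hu] at e2
    rw [← dist_eq_norm, ← dist_eq_norm, hpa, hpb] at e1 e2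
    rw [real_inner_self_eq_norm_sq]
    linarith
  have hcu : ⟪wc, u⟫ = 0 := by rw [hwc]; exact hperp c hca hcb
  have hdu : ⟪wd, u⟫ = 0 := by rw [hwd]; exact hperp d hda hdb
  have hcc : ⟪wc, wc⟫ = 4 - ‖u‖ ^ 2 := by rw [hwc]; exact hnorm c hca hcb
  have hdd : ⟪wd, wd⟫ = 4 - ‖u‖ ^ 2 := by rw [hwd]; exact hnorm d hda hdb
  obtain ⟨α, β, hne, hrel⟩ := exists_rel_of_orthogonal_plane hu0 hcu hdu
  have e1 := inner_rel_two_eq_zero (v := wc) hrel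
  have e2 := inner_rel_two_eq_zero (v := wd) hrel
  rw [hcc, real_inner_comm wc wd] at e1
  rw [hdd] at e2
  -- with K = 4 − ‖u‖², m = ⟪wc, wd⟫: (K − m)(K + m) α = 0 = (K − m)(K + m) β
  have ha : (4 - ‖u‖ ^ 2 - ⟪wc, wd⟫) * (4 - ‖u‖ ^ 2 + ⟪wc, wd⟫) * α = 0 := by
    linear_combination (4 - ‖u‖ ^ 2) * e1 - ⟪wc, wd⟫ * e2
  have hb : (4 - ‖u‖ ^ 2 - ⟪wc, wd⟫) * (4 - ‖u‖ ^ 2 + ⟪wc, wd⟫) * β = 0 := by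
    linear_combination (4 - ‖u‖ ^ 2) * e2 - ⟪wc, wd⟫ * e1
  by_cases hp : 4 - ‖u‖ ^ 2 + ⟪wc, wd⟫ = 0
  · -- wc + wd = 0, i.e. c + d = a + b
    have h0 : ⟪wc + wd, wc + wd⟫ = 0 := by
      rw [inner_add_left, inner_add_right, inner_add_right, hcc, hdd, real_inner_comm wc wd]
      linarith
    have hsum : wc + wd = 0 := inner_self_eq_zero.1 h0
    have e : wc + wd = (2 : ℝ) • (c + d) - (2 : ℝ) • (a + b) := by rw [hwc, hwd, two_smul, two_smul]; abel
    rw [e, sub_eq_zero] at hsum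
    exact smul_right_injective _ (by norm_num : (2 : ℝ) ≠ 0) hsum
  · by_cases hm : 4 - ‖u‖ ^ 2 - ⟪wc, wd⟫ = 0
    · -- wc = wd, i.e. c = d: excluded
      exfalso
      have h0 : ⟪wc - wd, wc - wd⟫ = 0 := by
        rw [inner_sub_left, inner_sub_right, inner_sub_right, hcc, hdd, real_inner_comm wc wd]
        linarith
      have hdiff : wc - wd = 0 := inner_self_eq_zero.1 h0
      have e : wc - wd = (2 : ℝ) • (c - d) := by rw [hwc, hwd, two_smul]; abel
      rw [e, smul_eq_zero] at hdiff
      rcases hdiff with h | h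
      · norm_num at h
      · exact hcd (sub_eq_zero.1 h)
    · exfalso
      have hα : α = 0 := by
        rcases mul_eq_zero.1 ha with h | h
        · rcases mul_eq_zero.1 h with h' | h'
          · exact absurd h' hm
          · exact absurd h' hp
        · exact h
      have hβ : β = 0 := by
        rcases mul_eq_zero.1 hb with h | h
        · rcases mul_eq_zero.1 h with h' | h'
          · exact absurd h' hm
          · exact absurd h' hp
        · exact h
      rcases hne with h | h
      · exact h hα
      · exact h hβ

/-- A pair at distance `1` is a pair of distinct points. [folklore] -/
theorem ne_of_dist_eq_one {E : Type*} [MetricSpace E] {p q : E} (h : dist p q = 1) : p ≠ q := by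
  intro hpq
  rw [hpq, dist_self] at h
  exact zero_ne_one h

/-- **`K₄` is not a penny graph**: no four points of the plane are pairwise at distance `1`. [folklore] -/
theorem no_four_pairwise_dist_one_plane {a b c d : EuclideanSpace ℝ (Fin 2)} (hab : dist a b = 1) (hac : dist a c = 1)
    (had : dist a d = 1) (hbc : dist b c = 1) (hbd : dist b d = 1) (hcd : dist c d = 1) : False := by
  have h1 : c + d = a + b := add_eq_add_of_two_circles (ne_of_dist_eq_one hab) (ne_of_dist_eq_one hcd)
    (by rw [dist_comm]; exact hac) (by rw [dist_comm]; exact hbc) (by rw [dist_comm]; exact had)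
    (by rw [dist_comm]; exact hbd)
  have h2 : b + d = a + c := add_eq_add_of_two_circles (ne_of_dist_eq_one hac) (ne_of_dist_eq_one hbd)
    (by rw [dist_comm]; exact hab) hbc (by rw [dist_comm]; exact had) (by rw [dist_comm]; exact hcd)
  have e : c - b = -(c - b) := by
    have := congrArg₂ (· - ·) h1 h2
    rw [neg_sub]
    calc c - b = c + d - (b + d) := by abel
      _ = a + b - (a + c) := this
      _ = b - c := by abel
  rw [eq_neg_iff_add_eq_zero, ← two_smul ℝ, smul_eq_zero] at e
  rcases e with h | h
  · norm_num at h
  · exact ne_of_dist_eq_one hbc (sub_eq_zero.1 h).symm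

/-- **`K_{2,3}`-freeness**: two distinct points of the plane do not have three distinct common points at distance `1`.
[folklore] -/
theorem common_neighbours_le_two_plane {a b c d e : EuclideanSpace ℝ (Fin 2)} (hab : a ≠ b) (hcd : c ≠ d) (hce : c ≠ e)
    (hde : d ≠ e) (hca : dist c a = 1) (hcb : dist c b = 1) (hda : dist d a = 1) (hdb : dist d b = 1)
    (hea : dist e a = 1) (heb : dist e b = 1) : False := by
  have h1 := add_eq_add_of_two_circles hab hcd hca hcb hda hdb
  have h2 := add_eq_add_of_two_circles hab hce hca hcb hea heb
  exact hde (add_left_cancel (h1.trans h2.symm))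

/-! ### The wheel `W₅` -/

/-- The kernel of the Gram matrix `[[1,1/2,t],[1/2,1,1/2],[t,1/2,1]]` is trivial unless `t = 1` or `t = -1/2`
(`det = -(2t+1)(t-1)/… `). [folklore] -/
theorem gram_wheel_step {α β γ t : ℝ} (h1 : α + β / 2 + t * γ = 0) (h2 : α / 2 + β + γ / 2 = 0)
    (h3 : t * α + β / 2 + γ = 0) (hne : α ≠ 0 ∨ β ≠ 0 ∨ γ ≠ 0) : t = 1 ∨ t = -1 / 2 := by
  by_contra hcon
  push Not at hcon
  have hD : (9 - (4 * t - 1) ^ 2) ≠ 0 := by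
    have e : 9 - (4 * t - 1) ^ 2 = -8 * ((t - 1) * (2 * t + 1)) := by ring
    rw [e]
    refine mul_ne_zero (by norm_num) (mul_ne_zero (sub_ne_zero.2 hcon.1) ?_)
    intro h
    exact hcon.2 (by linarith)
  have e1 : 3 * α + (4 * t - 1) * γ = 0 := by linear_combination 4 * h1 - 2 * h2
  have e3 : (4 * t - 1) * α + 3 * γ = 0 := by linear_combination 4 * h3 - 2 * h2
  have ha : (9 - (4 * t - 1) ^ 2) * α = 0 := by linear_combination 3 * e1 - (4 * t - 1) * e3
  have hc : (9 - (4 * t - 1) ^ 2) * γ = 0 := by linear_combination 3 * e3 - (4 * t - 1) * e1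
  have hα : α = 0 := (mul_eq_zero.1 ha).resolve_left hD
  have hγ : γ = 0 := (mul_eq_zero.1 hc).resolve_left hD
  have hβ : β = 0 := by rw [hα, hγ] at h2; linarith
  rcases hne with h | h | h
  · exact h hα
  · exact h hβ
  · exact h hγ

/-- **The wheel `W₅` is not a penny graph.** If five points `C i` are at distance `1` from `O`, consecutive ones
(cyclically) at distance `1`, and `dist (C 1) (C 3) ≥ 1`, `dist (C 0) (C 3) ≥ 1`, we reach a contradiction
(five angles of `60°` do not close up). [folklore] -/
theorem no_planar_five_ring (O : EuclideanSpace ℝ (Fin 2)) (C : Fin 5 → EuclideanSpace ℝ (Fin 2))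
    (hO : ∀ i, dist (C i) O = 1) (h01 : dist (C 0) (C 1) = 1) (h12 : dist (C 1) (C 2) = 1)
    (h23 : dist (C 2) (C 3) = 1) (h34 : dist (C 3) (C 4) = 1) (h40 : dist (C 4) (C 0) = 1)
    (h13 : 1 ≤ dist (C 1) (C 3)) (h03 : 1 ≤ dist (C 0) (C 3)) : False := by
  obtain ⟨v, hv⟩ : ∃ v : Fin 5 → EuclideanSpace ℝ (Fin 2), ∀ i, v i = C i - O := ⟨_, fun i => rfl⟩
  have hvv : ∀ i, ⟪v i, v i⟫ = 1 := by
    intro i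
    rw [real_inner_self_eq_norm_sq, hv, ← dist_eq_norm, hO i]
    norm_num
  have hvij : ∀ i j, ⟪v i, v j⟫ = 1 - dist (C i) (C j) ^ 2 / 2 := by
    intro i j
    have e1 := norm_sub_sq_real (v i) (v j)
    have e2 : v i - v j = C i - C j := by rw [hv, hv]; abel
    rw [e2, ← dist_eq_norm, ← real_inner_self_eq_norm_sq, ← real_inner_self_eq_norm_sq, hvv, hvv] at e1
    linarith
  have hc : ∀ i j, dist (C i) (C j) = 1 → ⟪v i, v j⟫ = 1 / 2 := fun i j h => by rw [hvij, h]; norm_num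
  have hle : ∀ i j, 1 ≤ dist (C i) (C j) → ⟪v i, v j⟫ ≤ 1 / 2 := fun i j h => by rw [hvij]; nlinarith
  have c01 := hc 0 1 h01
  have c12 := hc 1 2 h12
  have c23 := hc 2 3 h23
  have c34 := hc 3 4 h34
  have c40 := hc 4 0 h40
  have c10 : ⟪v 1, v 0⟫ = 1 / 2 := by rw [real_inner_comm]; exact c01
  have c21 : ⟪v 2, v 1⟫ = 1 / 2 := by rw [real_inner_comm]; exact c12
  have c32 : ⟪v 3, v 2⟫ = 1 / 2 := by rw [real_inner_comm]; exact c23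
  have c43 : ⟪v 4, v 3⟫ = 1 / 2 := by rw [real_inner_comm]; exact c34
  have c04 : ⟪v 0, v 4⟫ = 1 / 2 := by rw [real_inner_comm]; exact c40
  -- step 1: ⟪v 1, v 3⟫ = -1/2
  have t13 : ⟪v 1, v 3⟫ = -1 / 2 := by
    obtain ⟨α, β, γ, hne, hrel⟩ := exists_rel_three_plane (v 1) (v 2) (v 3)
    have e1 := inner_rel_three_eq_zero (v := v 1) hrel
    have e2 := inner_rel_three_eq_zero (v := v 2) hrel
    have e3 := inner_rel_three_eq_zero (v := v 3) hrel
    rw [hvv, c21, real_inner_comm (v 1) (v 3)] at e1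
    rw [c12, hvv, c32] at e2
    rw [c23, hvv] at e3
    have h := gram_wheel_step (t := ⟪v 1, v 3⟫) (by linarith) (by linarith) (by linarith) hne
    rcases h with h | h
    · linarith [hle 1 3 h13]
    · exact h
  -- step 2: ⟪v 3, v 0⟫ = -1/2
  have t30 : ⟪v 3, v 0⟫ = -1 / 2 := by
    obtain ⟨α, β, γ, hne, hrel⟩ := exists_rel_three_plane (v 3) (v 4) (v 0)
    have e1 := inner_rel_three_eq_zero (v := v 3) hrel
    have e2 := inner_rel_three_eq_zero (v := v 4) hrel
    have e3 := inner_rel_three_eq_zero (v := v 0) hrel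
    rw [hvv, c43, real_inner_comm (v 3) (v 0)] at e1
    rw [c34, hvv, c04] at e2
    rw [c40, hvv] at e3
    have h30 : 1 ≤ dist (C 3) (C 0) := by rw [dist_comm]; exact h03
    have h := gram_wheel_step (t := ⟪v 3, v 0⟫) (by linarith) (by linarith) (by linarith) hne
    rcases h with h | h
    · linarith [hle 3 0 h30]
    · exact h
  -- step 3: (v 0, v 1, v 3) has a non-singular Gram matrix
  obtain ⟨α, β, γ, hne, hrel⟩ := exists_rel_three_plane (v 0) (v 1) (v 3)
  have e1 := inner_rel_three_eq_zero (v := v 0) hrel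
  have e2 := inner_rel_three_eq_zero (v := v 1) hrel
  have e3 := inner_rel_three_eq_zero (v := v 3) hrel
  rw [hvv, c10, t30] at e1
  rw [c01, hvv, real_inner_comm (v 1) (v 3), t13] at e2
  have t03 : ⟪v 0, v 3⟫ = -1 / 2 := by rw [real_inner_comm]; exact t30
  rw [t03, t13, hvv] at e3
  have hα : α = 0 := by linarith
  have hβ : β = 0 := by linarith
  have hγ : γ = 0 := by linarith
  rcases hne with h | h | h
  · exact h hα
  · exact h hβ
  · exact h hγ

end Summit.Ventures.Crystal3D

end
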